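import Mathlib
import Summits.NavierStokesRegularity.NavierStokesRegularity.Theorems.EulerZoomLiouvillePowerGaugeEulerLiouvilleCondenserSharpPackingOn
import Summits.NavierStokesRegularity.NavierStokesRegularity.Theorems.EulerZoomLiouvillePowerGaugeEulerLiouvilleCondenserPackingMultiplier
import Summits.NavierStokesRegularity.NavierStokesRegularity.Theorems.EulerZoomLiouvillePowerGaugeEulerLiouvilleCondenserWeightedQuietSliceOn

/-!
# THEOREM P ON MOST HEIGHTS (plate P_w, nsreg-p2 g35 ROUND-45 `r45/Sketch45c.lean` `NsregP2.R45.PackingMultiplierMostHeights`;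
ref3 SCORE-p2-ROUND-45 F5)

Width piece for crux `EulerZoomLiouville.PowerGaugeEulerLiouville` (stmt-NavierStokesRegularity-19832), by name under
LEAD 19832 (ns-typeII-p2 g13); seat ns-sfl-p1 g6, `--supports stmt-NavierStokesRegularity-19832 --as helper`.

* **`packingMultiplierMostHeights`** — the Sketch45c text VERBATIM: THEOREM P (`Condenser.packingMultiplier`, t47-P) with
  the separation hypothesis weakened from «`2r`-separated at EVERY common height `≥ R`» to «`2r`-separated at every common
  height of a measurable set `T ⊆ [R, Λ'R]` of measure `≥ (1−η')(Λ'−1)R`»; price: the constant's `Λ'³ − 1` becomes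
  `μ'³ − 1`, `μ' = 1 + (1−η')(Λ'−1)`.  Proof: `Condenser.exists_slice_packing_alternative_of_segments_on` with the
  quiet-slice selector instantiated by ns-ezl-w2 g4's `Condenser.weightedQuietSlice_on` (the (Q)-run on the prescribed
  height set `T`, Markov loss `η := t`, bathtub on the good heights inside `T`), at the internal loss parameter
  `t ≤ min(1/4, (1−η')/2)` of `exists_loss_parameter_mostHeights` (`μ = 1 + (1−t−η')(Λ'−1)`), then the t47-P margin lemmas
  (`packing_amplitude_le`, `sharp_drop_absurd`, `packing_exp_absurd`, `sharpExponent_identity` × `N`) verbatim.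
  `η' = 0`, `T = [R, Λ'R]` recovers THEOREM P.

HONEST FRAMING: real analysis in `ℝ³` (with a cut-off flow); nothing here proves the crux E (19832 OPEN), any door
Target, or any Navier–Stokes statement; no summit statement is touched. [nsreg-p2 ROUND-45 (P_w); folklore
(length–area method, additivity of capacity); cite: ConstantinIgnatovaVicol2026Putative, §3.4.1 for the setting]
-/

noncomputable section

open Set Filter Topology Metric Function MeasureTheory Real
open scoped RealInnerProductSpace

set_option linter.dupNamespace false

namespace Summit.NavierStokesRegularity.NavierStokesRegularity.Theorems.PowerGaugeEulerLiouville.Condenser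

open Literature.Analysis Literature.Analysis.FluidPDE

/-- Choice of the loss parameter for THEOREM P on most heights: `t ∈ (0, 1/4]` with `t + η' < 1` and
`κ' < N·2π(1−2t)²γ²((1+(1−t−η')(Λ'−1))³−1)/(3C_E(Λ+1)^{1−ρ})`, by continuity at `t = 0`. [folklore] -/
theorem exists_loss_parameter_mostHeights {γ ρ C_E Λ Λ' η' κ' : ℝ} {N : ℕ} (hη' : η' < 1)
    (hκ : κ' < N * (2 * Real.pi * γ ^ 2 * ((1 + (1 - η') * (Λ' - 1)) ^ 3 - 1) / (3 * (Λ + 1) ^ (1 - ρ) * C_E))) :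
    ∃ t : ℝ, 0 < t ∧ t ≤ 1 / 4 ∧ t + η' < 1 ∧
      κ' < N * (2 * Real.pi * (1 - 2 * t) ^ 2 * γ ^ 2 * ((1 + (1 - t - η') * (Λ' - 1)) ^ 3 - 1) /
        (3 * C_E * (Λ + 1) ^ (1 - ρ))) := by
  set f : ℝ → ℝ := fun t => N * (2 * Real.pi * (1 - 2 * t) ^ 2 * γ ^ 2 * ((1 + (1 - t - η') * (Λ' - 1)) ^ 3 - 1) /
    (3 * C_E * (Λ + 1) ^ (1 - ρ))) with hf
  have hfc : Continuous f := by
    simp only [hf]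
    fun_prop
  have hf0 : f 0 = N * (2 * Real.pi * γ ^ 2 * ((1 + (1 - η') * (Λ' - 1)) ^ 3 - 1) / (3 * (Λ + 1) ^ (1 - ρ) * C_E)) := by
    simp only [hf]; ring
  have hev : ∀ᶠ t in 𝓝 (0 : ℝ), κ' < f t := hfc.continuousAt.eventually (lt_mem_nhds (by rw [hf0]; exact hκ))
  obtain ⟨ε, hε, hball⟩ := Metric.eventually_nhds_iff.1 hev
  have hη2 : 0 < (1 - η') / 2 := by linarith
  refine ⟨min (min (ε / 2) (1 / 4)) ((1 - η') / 2), by positivity, (min_le_left _ _).trans (min_le_right _ _),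
    by linarith [min_le_right (min (ε / 2) (1 / 4)) ((1 - η') / 2)], ?_⟩
  have h := hball (y := min (min (ε / 2) (1 / 4)) ((1 - η') / 2)) (by
    rw [Real.dist_eq, sub_zero, abs_of_pos (by positivity)]
    exact ((min_le_left _ _).trans (min_le_left _ _)).trans_lt (by linarith))
  simpa only [hf] using h

/-- **THEOREM P ON MOST HEIGHTS** (`NsregP2.R45.PackingMultiplierMostHeights` of `r45/Sketch45c.lean` VERBATIM; ref3
SCORE-p2-ROUND-45 F5).  See the module docstring. [nsreg-p2 ROUND-45 (P_w); folklore (length–area method, additivity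
of capacity); cite: ConstantinIgnatovaVicol2026Putative, §3.4.1 for the setting] -/
theorem packingMultiplierMostHeights :
    ∀ (γ ρ C_A C_E Λ Λ' η' κ' : ℝ) (N : ℕ), 0 < γ → 0 ≤ ρ → 0 < C_A → 0 < C_E → 1 < Λ' → Λ' ≤ Λ → 0 ≤ η' → η' < 1 →
      1 ≤ N →
      κ' < N * (2 * Real.pi * γ ^ 2 * ((1 + (1 - η') * (Λ' - 1)) ^ 3 - 1) / (3 * (Λ + 1) ^ (1 - ρ) * C_E)) →
      ∃ R₁ c₀ : ℝ, 0 < R₁ ∧ 0 < c₀ ∧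
        ∀ (V : EuclideanSpace ℝ (Fin 3) → EuclideanSpace ℝ (Fin 3)) (K : ℝ), ContDiff ℝ 1 V →
          (∀ y, ‖fderiv ℝ V y‖ ≤ K) →
          ∀ R r : ℝ, R₁ ≤ R → c₀ * R ^ (-(1 + ρ)) ≤ r → r ≤ R / 2 →
            (∫ x in ball (0 : EuclideanSpace ℝ (Fin 3)) ((Λ + 1) * R), ‖V x‖ ^ 2 ≤
                C_A * ((Λ + 1) * R) ^ (1 - 2 * ρ)) →
            (∫ x in ball (0 : EuclideanSpace ℝ (Fin 3)) ((Λ + 1) * R), ‖fderiv ℝ V x‖ ^ 2 ≤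
                C_E * ((Λ + 1) * R) ^ (1 - ρ)) →
            ∀ (e : EuclideanSpace ℝ (Fin 3)), ‖e‖ = 1 →
            ∀ (y : Fin N → EuclideanSpace ℝ (Fin 3)) (L : Fin N → ℝ), (∀ i, 0 ≤ L i) → (∀ i, ‖y i‖ < R) →
              (∀ i, ∀ t ∈ Icc 0 (L i),
                ‖ODE.evolutionMap (fun _ : ℝ => selfSimilarTransport γ 0 V) 0 (-t) (y i)‖ ≤ Λ * R) →
              (∀ i, Λ' * R ≤ ⟪ODE.evolutionMap (fun _ : ℝ => selfSimilarTransport γ 0 V) 0 (-(L i)) (y i), e⟫) →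
              (∃ T : Set ℝ, T ⊆ Icc R (Λ' * R) ∧ MeasurableSet T ∧ (1 - η') * ((Λ' - 1) * R) ≤ volume.real T ∧
                ∀ s ∈ T, ∀ i j, i ≠ j → ∀ t ∈ Icc 0 (L i), ∀ t' ∈ Icc 0 (L j),
                  ⟪ODE.evolutionMap (fun _ : ℝ => selfSimilarTransport γ 0 V) 0 (-t) (y i), e⟫ = s →
                  ⟪ODE.evolutionMap (fun _ : ℝ => selfSimilarTransport γ 0 V) 0 (-t') (y j), e⟫ = s →
                  2 * r < ‖ODE.evolutionMap (fun _ : ℝ => selfSimilarTransport γ 0 V) 0 (-t) (y i) -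
                    ODE.evolutionMap (fun _ : ℝ => selfSimilarTransport γ 0 V) 0 (-t') (y j)‖) →
              ∃ z ∈ ball (0 : EuclideanSpace ℝ (Fin 3)) ((Λ + 1) * R),
                Real.exp (κ' * R ^ (2 + ρ)) ≤ ‖fderiv ℝ V z‖ := by
  intro γ ρ C_A C_E Λ Λ' η' κ' N hγ hρ hCA hCE hΛ' _ _ hη'1 hN hκ
  have hπ : 0 < Real.pi := Real.pi_pos
  have hΛ1 : 0 < Λ + 1 := by linarith
  have hΛm : 0 < Λ' - 1 := by linarith
  -- the loss parameter and the raised packed coefficient `κ_N = N κ₁(t) > κ'`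
  obtain ⟨t, ht0, ht4, htη, hκN⟩ := exists_loss_parameter_mostHeights (γ := γ) (ρ := ρ) (C_E := C_E) (Λ := Λ)
    (Λ' := Λ') hη'1 hκ
  have ht1 : t < 1 := by linarith
  have hμ : 1 < 1 + (1 - t - η') * (Λ' - 1) := by nlinarith
  have hμ3 : 0 < (1 + (1 - t - η') * (Λ' - 1)) ^ 3 - 1 := by
    nlinarith [pow_lt_pow_left₀ hμ zero_le_one three_ne_zero]
  obtain ⟨κN, hκNdef⟩ : ∃ κN : ℝ, κN = N * (2 * Real.pi * (1 - 2 * t) ^ 2 * γ ^ 2 *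
      ((1 + (1 - t - η') * (Λ' - 1)) ^ 3 - 1) / (3 * C_E * (Λ + 1) ^ (1 - ρ))) := ⟨_, rfl⟩
  rw [← hκNdef] at hκN
  have hgap : 0 < κN - κ' := sub_pos.2 hκN
  -- the disc-radius floor constant and the threshold radius
  obtain ⟨c₀, hc₀def⟩ : ∃ c₀ : ℝ,
      c₀ = Real.sqrt (2 * C_A * (Λ + 1) ^ (1 - 2 * ρ) / (Real.pi * t ^ 3 * γ ^ 2 * (Λ' - 1))) := ⟨_, rfl⟩
  have hL2 : 0 < (Λ + 1) ^ (1 - 2 * ρ) := Real.rpow_pos_of_pos hΛ1 _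
  have hc₀ : 0 < c₀ := by rw [hc₀def]; exact Real.sqrt_pos.2 (by positivity)
  refine ⟨max 1 (|Real.log (2 * t * γ)| / (κN - κ') + 1), c₀, lt_max_of_lt_left one_pos, hc₀, ?_⟩
  intro V K hV hK R r hR hc₀r hr2 hA hE e he y L hL hy hstay hcap hT
  obtain ⟨T, hTJ, hTm, hTvol, hsepT⟩ := hT
  have h1 : 1 ≤ R := (le_max_left _ _).trans hR
  have hRb : |Real.log (2 * t * γ)| / (κN - κ') + 1 ≤ R := (le_max_right _ _).trans hR
  have hR0 : 0 < R := by linarith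
  have hr0 : 0 < r := lt_of_lt_of_le (mul_pos hc₀ (Real.rpow_pos_of_pos hR0 _)) hc₀r
  have hX : 0 < C_A * ((Λ + 1) * R) ^ (1 - 2 * ρ) := mul_pos hCA (Real.rpow_pos_of_pos (by positivity) _)
  have hY : 0 < C_E * ((Λ + 1) * R) ^ (1 - ρ) := mul_pos hCE (Real.rpow_pos_of_pos (by positivity) _)
  -- the slice energy on `T` and the quiet-slice selector (the (Q)-run on `T`, ns-ezl-w2 g4)
  have hET : ∀ s ∈ T, 0 < 3 * (C_E * ((Λ + 1) * R) ^ (1 - ρ)) /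
      (((1 + (1 - t - η') * (Λ' - 1)) ^ 3 - 1) * R ^ 3) * s ^ 2 := by
    intro s hs
    have hspos : 0 < s := hR0.trans_le (hTJ hs).1
    exact mul_pos (div_pos (by positivity) (mul_pos hμ3 (by positivity))) (by positivity)
  have hQT : ∀ (F G : EuclideanSpace ℝ (Fin 3) → ℝ), Continuous F → Continuous G → (∀ x, 0 ≤ F x) →
      (∀ x, 0 ≤ G x) →
      (∫ x in ball (0 : EuclideanSpace ℝ (Fin 3)) ((Λ + 1) * R), F x ≤ C_A * ((Λ + 1) * R) ^ (1 - 2 * ρ)) →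
      (∫ x in ball (0 : EuclideanSpace ℝ (Fin 3)) ((Λ + 1) * R), G x ≤ C_E * ((Λ + 1) * R) ^ (1 - ρ)) →
      ∃ s ∈ T, ∫ a, (ball (0 : EuclideanSpace ℝ (Fin 3)) ((Λ + 1) * R)).indicator F (plane s a) ≤
          C_A * ((Λ + 1) * R) ^ (1 - 2 * ρ) / (t * (Λ' - 1) * R) ∧
        ∫ a, (ball (0 : EuclideanSpace ℝ (Fin 3)) ((Λ + 1) * R)).indicator G (plane s a) ≤
          3 * (C_E * ((Λ + 1) * R) ^ (1 - ρ)) / (((1 + (1 - t - η') * (Λ' - 1)) ^ 3 - 1) * R ^ 3) * s ^ 2 :=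
    fun F G hFc hGc hF0 hG0 hFX hGY =>
      weightedQuietSlice_on hFc hGc hF0 hG0 hR0 hΛ' ht0 htη hX hY hFX hGY hTm hTJ hTvol
  by_contra hcon
  push Not at hcon
  have hGm : ∀ z ∈ ball (0 : EuclideanSpace ℝ (Fin 3)) ((Λ + 1) * R),
      ‖fderiv ℝ V z‖ ≤ Real.exp (κ' * R ^ (2 + ρ)) := fun z hz => (hcon z hz).le
  obtain ⟨s, hsT, halt⟩ := exists_slice_packing_alternative_of_segments_on hV hK he hN hγ hR0 hTJ ht0 ht1 hr0 hr2 hET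
    hQT hA hE hGm hL hy hstay hcap hsepT
  have hsR : R ≤ s := (hTJ hsT).1
  have hm : 0 < γ * s := mul_pos hγ (hR0.trans_le hsR)
  -- the outer-mean term is `≤ tγR ≤ tγs`
  have hc₀r' : Real.sqrt (2 * C_A * (Λ + 1) ^ (1 - 2 * ρ) / (Real.pi * t ^ 3 * γ ^ 2 * (Λ' - 1))) *
      R ^ (-(1 + ρ)) ≤ r := by rw [← hc₀def]; exact hc₀r
  have haR := packing_amplitude_le (ρ := ρ) (r := r) hCA hΛ1 hΛ' ht0 hγ hR0 hc₀r'
  have haS : Real.sqrt (2 * (C_A * ((Λ + 1) * R) ^ (1 - 2 * ρ) / (t * (Λ' - 1) * R)) / Real.pi) / r ≤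
      t * (γ * s) := by
    have : t * γ * R ≤ t * γ * s := mul_le_mul_of_nonneg_left hsR (mul_pos ht0 hγ).le
    linarith
  rcases halt with h | h
  · exact sharp_drop_absurd ht4 hm haS h
  · have hP : R ≤ R ^ (2 + ρ) := by
      calc R = R ^ (1 : ℝ) := (Real.rpow_one R).symm
        _ ≤ R ^ (2 + ρ) := Real.rpow_le_rpow_of_exponent_le h1 (by linarith)
    have hid : κN * R ^ (2 + ρ) *
        (3 * (C_E * ((Λ + 1) * R) ^ (1 - ρ)) / (((1 + (1 - t - η') * (Λ' - 1)) ^ 3 - 1) * R ^ 3) * s ^ 2) =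
        N * (2 * Real.pi * (1 - 2 * t) ^ 2 * γ ^ 2 * s ^ 2) := by
      have h0 := sharpExponent_identity (γ := γ) (ρ := ρ) (t := t) (s := s) (μ := 1 + (1 - t - η') * (Λ' - 1))
        hCE hΛ1 hμ3 hR0
      rw [hκNdef, mul_assoc, mul_assoc, ← mul_assoc (2 * Real.pi * (1 - 2 * t) ^ 2 * γ ^ 2 *
        ((1 + (1 - t - η') * (Λ' - 1)) ^ 3 - 1) / (3 * C_E * (Λ + 1) ^ (1 - ρ))), h0]
    exact packing_exp_absurd hκN ht0 ht4 hγ hR0 hsR hr0 hr2 haS (hET s hsT) hP hid hRb h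

end Summit.NavierStokesRegularity.NavierStokesRegularity.Theorems.PowerGaugeEulerLiouville.Condenser

end
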